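import Literature.MathematicalPhysics.QuantumFieldTheory.Balaban1983to89.B9Eq373BondHessianTwoBackgroundLetterTower
import Literature.MathematicalPhysics.QuantumFieldTheory.Balaban1983to89.B9Eq375BondGradDivTwoBackgroundLetterTower
import Literature.MathematicalPhysics.QuantumFieldTheory.Balaban1983to89.B9Eq376BondProjWordTwoBackgroundLetterTower
import Literature.MathematicalPhysics.QuantumFieldTheory.Balaban1983to89.B9Eq382BondPenaltyTwoBackgroundLetterTower

/-!
# `Balaban1983to89.B9Eq386BondPropagatorTwoBackgroundLetterTower` — T. Bałaban, *Propagators for lattice gauge theories in a background field*, Commun. Math. Phys. **99** (1985)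
# 389–434 [Balaban1985BackgroundPropagators] (3.84)–(3.86) p. 407 *«Δ_a(U^η) = Δ_a(1) − V … G(U^η) = G(1)(I − V G(1))⁻¹ (3.86) … the operators V G(1) … have small norms»*,
# (3.71)–(3.82) pp. 405–407 (the pieces of `V`), (3.26) p. 395, Thm 3.3 p. 399, Thm 3.11 p. 416: **THE TWO-BACKGROUND LADDER OF THE `k`-LEVEL BOND PROPAGATOR
# `G₁,k = Δ_{a,k}⁻¹` AT THE FLAT BASE, AS A LOCAL LETTER WITH THE SMALL FACTOR `α`, CONSTANTS BEFORE THE LATTICE** — for a source `f` supported on the fine bonds of one big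
# block `Π⁻¹(v)` with `‖f‖_∞ ≤ F`: `‖(G₁,k(U)f − G₁,k(1)f)(b)‖ ≤ K·α·e^{−κ·d_m(Π(b₋), v)}·F`, `∃ α₀ K κ` FIRST, then `∀ n η m U …` (ROUTE (J′-G) «bond storey», closed)

statement-level skeleton of published theorems with citation tags; proofs where landed; nothing here is a claim about the Yang–Mills mass gap

CITATION HEADER (lean-in-tree rule).  Audit cell `pub-balaban`, sub-cell `t4`, BINDER row NE9; filed by NE9 crux-team LEAF PROVER 01 (`b2b-balaban-t4-ne9-formalise-leaf-01`, gen 100;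
ROUTE (J′-G) «bond storey»: memo `t4/b2b-balaban-t4-ne9-formalise-leaf-01/g100/ROUTE-JprimeG-BOND-STOREY-g100.md`).  Imports this lineage's four piece files — the Hessian
`B9Eq373BondHessianTwoBackgroundLetterTower.exists_letter_hessOp_sub_flat_G1k_one`, `D D†` `B9Eq375BondGradDivTwoBackgroundLetterTower.exists_letter_gradDiv_sub_flat_G1k_one`, the smooth word
`B9Eq376BondProjWordTwoBackgroundLetterTower.exists_letter_projWord_sub_flat_G1k_one`, the penalty `B9Eq382BondPenaltyTwoBackgroundLetterTower.exists_letter_penalty_sub_flat_G1k_one` — and,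
through them, ne9-leaf-03's MODEL row `B9Eq326G1kSupRowClosed.exists_local_letter_G1k` (read at `U`), `B9Eq326G1SupRowOfLetters.letter_comp`, `B9Eq349BlockMultipliers.exists_block_clm_family`,
`B9Eq326OperatorTower` (`laplaceAk`, `G1k`, `RofUk`, `QkW`), `B11Eq103H1Complex` (`greenK_apply`, `apply_greenK`).  Source READ first-hand in the held text layer
`paper:balaban1985-cmp99-background-propagators` pp. 405–407 ((3.71)–(3.86)), p. 395 (3.26), p. 399 (Thm 3.3), p. 416 (Thm 3.11).  NOTHING of print's proofs is reproduced:
[folklore] the first-order resolvent identity `G(U) − G(1) = G(U)·[Δ(1) − Δ(U)]·G(1)` + composition BY NAME of the landed piece letters.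

THE PRINT (verbatim, p. 407).  *«Gathering together the equalities (3.73), (3.77), (3.82) we get Δ_a(U^η) = Δ_a(1) − V₁(A) − V₂(A) − V₃(A) − P₁(A) − P₂(A) = Δ_a(1) − V, (3.84) … hence
G(U^η) = (Δ_a(1) − V)⁻¹ = G(1)(I − V G(1))⁻¹. (3.86) The operators V_i G(1), P_j G(1) are bounded and, by the estimates above, have small norms for α₀, α₁ small.»*  Here the
WEAKER first-order form is typed: `G(U) − G(1) = G(U)(Δ_a(1) − Δ_a(U))G(1)` with `(Δ_a(U) − Δ_a(1))G(1)` a local letter `K_V·α` (the four pieces) and `G(U)` a local letter at `U`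
(the MODEL row) — no Neumann series is summed (the smallness of `α` is NOT used to invert; `G(U)` exists by the displayed positivity).

WHAT IS PROVED (sorry-free; proof lane — 0 `def`; [folklore]).
* **`exists_letter_laplaceAk_sub_flat_G1k_one`** — the letter of `V·G₁,k(1) := (Δ_{a,k}(U) − Δ_{a,k}(1))G₁,k(1)`: `∃ α₀ K_V κ`, `‖((Δ_{a,k}(U) − Δ_{a,k}(1))G₁,k(1)f)(b)‖ ≤ K_V·α·e^{−κ d}·F`
  (`laplaceAk` unfolded by `rfl` into its three slots; `D R_k D† = D D† − D(1 − R_k)D†`; the four piece letters at the common rate; `norm_add₃_le`).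
* **`exists_letter_G1k_sub_flat`** — THE BOND STOREY: `∃ α₀ K κ > 0` such that along the whole class (height `n`, `ηL^{n+1} = 1`, weights `c₀(L^{n+1})^d = c₁`, torus `m ≥ 1`,
  background `U` with its four smallness letters at `0 ≤ α ≤ α₀`, unitary (`hUst`), displayed tower data with profiles `ε_j ≤ αr^j`, `Σα_j ≤ A_Q`, the positivity displays at `U`
  and at `1`) and every one-block source `f`: `‖(G₁,k(U)f − G₁,k(1)f)(b)‖ ≤ K·α·e^{−κ·d_m(Π(b₋),v)}·F` — `letter_comp` of the first bullet with the MODEL row of `G₁,k(U)`.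
HONEST SCOPE.  Composition BY NAME on the cell's MODEL rows of `G₁,k` (value + slice gradient; O-NE9-1, #5 UNRULED) and of `G′_k`, `R_k`; constants crude (products of the pieces'
constants and two lattice sums `K_d` — NOT print's); first-order identity only (no `(I − VG(1))⁻¹`); flat base only; the block family `rr` of the smooth-word piece is INHABITED here
(`exists_block_clm_family`), so it no longer appears among the binders; nothing of [B9] Thm 3.3 ∕ 3.4 ∕ Lemma 3.7 asserted; «NE9 ⇐ the named binders»; NE9 NOT PRINTED ∕ NOT
PROVED; spine PROVED 0∕9; rung (B)+1 on a finite T⁴ — NOT infinite volume, NOT mass gap, NOT BetaPertH, NOT Clay.  HONEST DEPENDENCY: continuum YM on T⁴ ⇐ BetaPertH ∧ nine spine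
estimates (0/9 proved); BetaPertH ⇐ (D1) ∧ (D4) ∧ CAP+tail; G-an2-4 gates asym, D1 and NE2/3/4.  NEW file; nothing modified.  Net new unproved facts: 0.
-/

noncomputable section

open scoped InnerProductSpace ComplexConjugate BigOperators

namespace Literature.MathematicalPhysics.QuantumFieldTheory.Balaban1983to89.B9Eq386BondPropagatorTwoBackgroundLetterTower

open B4Sect5Torus (TSite tdist tdist_nonneg tdist_triangle tdist_symm torusSum_le tdist_self)
open B4Sect5Proof (latticeConst latticeConst_nonneg)
open B9SectCLatticeCarrier (Bond bpos btgt shift unshift shift_unshift)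
open B9Eq311L2Pairing (WL2)
open B9Eq319QprimeTorus (blockCoord)
open B7Prop1Explicit (U1 Wcx boxVec)
open B11Eq103H1Complex (SiteL2K BondL2K covDerivL2K covDivL2K greenK_apply apply_greenK)
open B9Eq310DeltaPrime (plaqHolU)
open B9Eq310HessianOperator (adTransportW hessOp)
open B9Eq315QTorus (perCfg cornerSite)
open B9Eq315QTower (towerP UlevOf)
open B9Eq315QTowerFlat (perCfg_UlevOf_one_mem_U1 norm_Wcx_UlevOf_one_sub_one_le)
open B9Eq316TowerFlatIsOneStep (towerP_eq_fineP_pow siteCast)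
open B9Eq326OperatorTower (laplaceAk G1k RofUk QkW)
open B9Eq324DeltaPrimeATower (laplacePrimeAk)
open B9Eq349BlockMultipliers (exists_block_clm_family)
open B9Eq326G1kSupRowClosed (exists_local_letter_G1k)
open B9Eq326G1SupRowOfLetters (letter_comp)
open B9Eq373BondHessianTwoBackgroundLetterTower (exists_letter_hessOp_sub_flat_G1k_one)
open B9Eq375BondGradDivTwoBackgroundLetterTower (exists_letter_gradDiv_sub_flat_G1k_one)
open B9Eq376BondProjWordTwoBackgroundLetterTower (exists_letter_projWord_sub_flat_G1k_one)
open B9Eq382BondPenaltyTwoBackgroundLetterTower (exists_letter_penalty_sub_flat_G1k_one)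

variable {d : ℕ} (hd : 1 ≤ d) (L : ℕ) [NeZero L] (hL : 1 ≤ L) (hL3 : 3 ≤ L)
  {𝔸 : Type*} [NormedRing 𝔸] [NormedAlgebra ℂ 𝔸] [CompleteSpace 𝔸] [NormOneClass 𝔸] [StarRing 𝔸] [NormedStarGroup 𝔸] [StarModule ℂ 𝔸] [FiniteDimensional ℂ 𝔸]
  {W : Type*} [NormedAddCommGroup W] [InnerProductSpace ℂ W] [FiniteDimensional ℂ W] (φ : W ≃ₗ[ℂ] 𝔸)
  {Mφ Mφ' : ℝ} (hMφ : 0 ≤ Mφ) (hMφ' : 0 ≤ Mφ') (hφ : ∀ w, ‖φ w‖ ≤ Mφ * ‖w‖) (hφ' : ∀ X, ‖φ.symm X‖ ≤ Mφ' * ‖X‖) (hstar : ∀ X : 𝔸, ‖star X‖ ≤ ‖X‖)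
  {a : ℝ} (ha : 0 < a) {a' : ℝ} (ha' : 0 < a') {r : ℝ} (hr0 : 0 ≤ r) (hr1 : r < 1)
  (τ : 𝔸 →ₗ[ℂ] ℂ) {Cτ : ℝ} (hτ : ∀ X, ‖τ X‖ ≤ Cτ * ‖X‖) (hCτ : 0 ≤ Cτ) {Mτ : ℝ} (hτm : ∀ X Y : 𝔸, ‖τ (X * Y)‖ ≤ Mτ * ‖X‖ * ‖Y‖) (hMτ : 0 ≤ Mτ)
  {ρw : ℝ} (hρw : 0 ≤ ρw)
  (hτ₁ : ∀ X : 𝔸, τ (star X) = conj (τ X)) (hτ₂ : ∀ X Y : 𝔸, τ (X * Y) = τ (Y * X)) (hφτ : ∀ X Y : 𝔸, ⟪φ.symm X, φ.symm Y⟫_ℂ = τ (star X * Y))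
  {ι : Type} [Fintype ι] [DecidableEq ι] (b : Module.Basis ι ℝ 𝔸) {M₂ : ℝ} (hM₂ : 0 ≤ M₂) (hrepr : ∀ (v : 𝔸) (i : ι), |b.repr v i| ≤ M₂ * ‖v‖)
  (AQ : ℝ)

/-! ## §0 Unfoldings: the three slots of `Δ_{a,k}`, and `G₁,k Δ_{a,k} = Δ_{a,k} G₁,k = 1` -/

omit [NormedStarGroup 𝔸] [FiniteDimensional ℂ 𝔸] in
/-- `Δ_{a,k}(U)x = Δ(U)x + D_U(R_k(U)(D*_Ux)) + Q_k(U)†(a·Q_k(U)x)` (`laplaceAK_apply` at the tower letters; `rfl`). [cite: Balaban1985BackgroundPropagators, (3.26) p.395] -/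
theorem laplaceAk_apply_slots (n : ℕ) (η : ℝ) {c₀ c₁ : ℝ} [Fact (0 < c₀)] [Fact (0 < c₁)] (m : Fin d → ℕ) [∀ i, NeZero (m i)]
    (U : Bond d (towerP L m (n + 1)) → 𝔸ˣ) (αU : ℕ → ℝ) (hα1 : ∀ j, αU j ≤ 1 / 64)
    (hU1 : ∀ (j : ℕ) (x : B7Prop1Explicit.Site d) (k : Fin d), perCfg (towerP L m (j + 1)) (UlevOf L m (n + 1) U j) x k ∈ U1 𝔸)
    (hreg : ∀ (j : ℕ) (y : TSite d (towerP L m j)) (k : Fin d) (ρ' : Fin d → Fin L),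
      ‖((Wcx L (perCfg (towerP L m (j + 1)) (UlevOf L m (n + 1) U j)) (cornerSite L y) k (boxVec L ρ') : 𝔸ˣ) : 𝔸) - 1‖ ≤ αU j)
    (x : BondL2K ℂ d (towerP L m (n + 1)) c₀ W) :
    laplaceAk L m n φ η U hL αU hα1 hU1 hreg τ (c₀ := c₀) (c₁ := c₁) a x =
      hessOp φ η U τ x +
        covDerivL2K ℂ c₀ ((η : ℂ))⁻¹ (adTransportW φ U)
          (RofUk L m n φ η U (c₀ := c₀) (covDivL2K ℂ c₀ ((η : ℂ))⁻¹ (adTransportW φ fun b' => (U b')⁻¹) x)) +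
        LinearMap.adjoint (QkW L m n φ U hL αU hα1 hU1 hreg (c₀ := c₀) (c₁ := c₁))
          ((a : ℂ) • QkW L m n φ U hL αU hα1 hU1 hreg (c₀ := c₀) (c₁ := c₁) x) := rfl

omit [NormedStarGroup 𝔸] [FiniteDimensional ℂ 𝔸] in
/-- `G₁,k(U)(Δ_{a,k}(U)x) = x` (finite dimension: the constructed right inverse is a left inverse, `greenK_apply`). [folklore]
[cite: Balaban1985BackgroundPropagators, Thm 3.11 p.416; Balaban1985Variational, (110) p.294] -/
theorem G1k_laplaceAk_apply (n : ℕ) (η : ℝ) {c₀ c₁ : ℝ} [Fact (0 < c₀)] [Fact (0 < c₁)] (m : Fin d → ℕ) [∀ i, NeZero (m i)]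
    (U : Bond d (towerP L m (n + 1)) → 𝔸ˣ) (αU : ℕ → ℝ) (hα1 : ∀ j, αU j ≤ 1 / 64)
    (hU1 : ∀ (j : ℕ) (x : B7Prop1Explicit.Site d) (k : Fin d), perCfg (towerP L m (j + 1)) (UlevOf L m (n + 1) U j) x k ∈ U1 𝔸)
    (hreg : ∀ (j : ℕ) (y : TSite d (towerP L m j)) (k : Fin d) (ρ' : Fin d → Fin L),
      ‖((Wcx L (perCfg (towerP L m (j + 1)) (UlevOf L m (n + 1) U j)) (cornerSite L y) k (boxVec L ρ') : 𝔸ˣ) : 𝔸) - 1‖ ≤ αU j)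
    (hpos : ∀ x : BondL2K ℂ d (towerP L m (n + 1)) c₀ W, x ≠ 0 →
      0 < RCLike.re ⟪x, laplaceAk L m n φ η U hL αU hα1 hU1 hreg τ (c₀ := c₀) (c₁ := c₁) a x⟫_ℂ)
    (x : BondL2K ℂ d (towerP L m (n + 1)) c₀ W) :
    G1k L m n φ η U hL αU hα1 hU1 hreg τ (c₀ := c₀) (c₁ := c₁) hpos (laplaceAk L m n φ η U hL αU hα1 hU1 hreg τ (c₀ := c₀) (c₁ := c₁) a x) = x := by
  unfold G1k B11Eq103H1Complex.G1LatticeK B11Eq103H1Complex.G1K laplaceAk B11Eq103H1Complex.laplaceALatticeK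
  rw [greenK_apply]

omit [NormedStarGroup 𝔸] [FiniteDimensional ℂ 𝔸] in
/-- `Δ_{a,k}(U)(G₁,k(U)x) = x` (`apply_greenK`). [folklore] [cite: Balaban1985BackgroundPropagators, Thm 3.11 p.416; Balaban1985Variational, (110) p.294] -/
theorem laplaceAk_G1k_apply (n : ℕ) (η : ℝ) {c₀ c₁ : ℝ} [Fact (0 < c₀)] [Fact (0 < c₁)] (m : Fin d → ℕ) [∀ i, NeZero (m i)]
    (U : Bond d (towerP L m (n + 1)) → 𝔸ˣ) (αU : ℕ → ℝ) (hα1 : ∀ j, αU j ≤ 1 / 64)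
    (hU1 : ∀ (j : ℕ) (x : B7Prop1Explicit.Site d) (k : Fin d), perCfg (towerP L m (j + 1)) (UlevOf L m (n + 1) U j) x k ∈ U1 𝔸)
    (hreg : ∀ (j : ℕ) (y : TSite d (towerP L m j)) (k : Fin d) (ρ' : Fin d → Fin L),
      ‖((Wcx L (perCfg (towerP L m (j + 1)) (UlevOf L m (n + 1) U j)) (cornerSite L y) k (boxVec L ρ') : 𝔸ˣ) : 𝔸) - 1‖ ≤ αU j)
    (hpos : ∀ x : BondL2K ℂ d (towerP L m (n + 1)) c₀ W, x ≠ 0 →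
      0 < RCLike.re ⟪x, laplaceAk L m n φ η U hL αU hα1 hU1 hreg τ (c₀ := c₀) (c₁ := c₁) a x⟫_ℂ)
    (x : BondL2K ℂ d (towerP L m (n + 1)) c₀ W) :
    laplaceAk L m n φ η U hL αU hα1 hU1 hreg τ (c₀ := c₀) (c₁ := c₁) a (G1k L m n φ η U hL αU hα1 hU1 hreg τ (c₀ := c₀) (c₁ := c₁) hpos x) = x := by
  unfold G1k B11Eq103H1Complex.G1LatticeK B11Eq103H1Complex.G1K laplaceAk B11Eq103H1Complex.laplaceALatticeK
  rw [apply_greenK]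

/-! ## §1 The letter of `V·G₁,k(1) = (Δ_{a,k}(U) − Δ_{a,k}(1))G₁,k(1)`: the four pieces summed -/

include hd hL hL3 hMφ hMφ' hφ hφ' hstar ha ha' hr0 hr1 hτ hCτ hτm hMτ hρw hτ₁ hτ₂ hφτ hM₂ hrepr in
set_option maxHeartbeats 3200000 in
/-- **`(Δ_{a,k}(U) − Δ_{a,k}(1))G₁,k(1)` AS A LOCAL LETTER WITH THE SMALL FACTOR, CONSTANTS BEFORE THE LATTICE** — the sum of the four landed piece letters (Hessian, `D D†`,
smooth word `−D(1 − R_k)D†`, penalty) at their common rate; see the module docstring. [cite: Balaban1985BackgroundPropagators, (3.84)–(3.85) p.407, (3.71)–(3.82) pp.405–407, (3.26) p.395] -/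
theorem exists_letter_laplaceAk_sub_flat_G1k_one :
    ∃ α₀ K κ : ℝ, 0 < α₀ ∧ 0 ≤ K ∧ 0 < κ ∧
      ∀ (n : ℕ) (η : ℝ), η * (L : ℝ) ^ (n + 1) = 1 →
      ∀ (c₀ c₁ : ℝ) [Fact (0 < c₀)] [Fact (0 < c₁)], c₀ * ((L : ℝ) ^ (n + 1)) ^ d = c₁ → |η| ^ d / c₀ ≤ ρw →
      ∀ (m : Fin d → ℕ) [∀ i, NeZero (m i)], (∀ i, 1 ≤ m i) → ∀ (U : Bond d (towerP L m (n + 1)) → 𝔸ˣ) (α : ℝ), 0 ≤ α → α ≤ α₀ →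
        (∀ bd, U bd ∈ U1 𝔸) → (∀ bd, ‖(U bd : 𝔸) - 1‖ ≤ α * η) →
        (∀ (x : TSite d (towerP L m (n + 1))) (μ ν : Fin d), ‖(U (shift ν x, μ) : 𝔸) - (U (x, μ) : 𝔸)‖ ≤ α * η ^ 2) →
        (∀ p : B9SectCLatticeCarrier.Plaq d (towerP L m (n + 1)), ‖(plaqHolU U p : 𝔸) - 1‖ ≤ α * η ^ 2) →
      ∀ (hUst : ∀ bd, star (U bd : 𝔸) = (((U bd)⁻¹ : 𝔸ˣ) : 𝔸))
        (αU : ℕ → ℝ), (∀ j, 0 ≤ αU j) → ∀ (hα1 : ∀ j, αU j ≤ 1 / 64), (∑ j ∈ Finset.range (n + 1), αU j ≤ AQ) →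
        ∀ (hU1 : ∀ (j : ℕ) (x : B7Prop1Explicit.Site d) (k : Fin d), perCfg (towerP L m (j + 1)) (UlevOf L m (n + 1) U j) x k ∈ U1 𝔸)
        (hreg : ∀ (j : ℕ) (y : TSite d (towerP L m j)) (k : Fin d) (ρ' : Fin d → Fin L),
          ‖((Wcx L (perCfg (towerP L m (j + 1)) (UlevOf L m (n + 1) U j)) (cornerSite L y) k (boxVec L ρ') : 𝔸ˣ) : 𝔸) - 1‖ ≤ αU j),
      ∀ (εU : ℕ → ℝ), (∀ j, 0 ≤ εU j) → (∀ j, εU j ≤ 1) → (∀ j < n + 1, εU j ≤ α * r ^ j) →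
        (∀ (j : ℕ) (bd : Bond d (towerP L m (j + 1))), ‖(UlevOf L m (n + 1) U j bd : 𝔸) - 1‖ ≤ εU j) →
        (∀ (j : ℕ) (bd : Bond d (towerP L m (j + 1))), UlevOf L m (n + 1) U j bd ∈ U1 𝔸) →
        (∀ (j : ℕ) (bd : Bond d (towerP L m (j + 1))) (w : W), ‖adTransportW φ (UlevOf L m (n + 1) U j) bd w‖ ≤ ‖w‖) →
      ∀ (hposU' : ∀ x : SiteL2K ℂ d (towerP L m (n + 1)) c₀ W, x ≠ 0 → 0 < RCLike.re ⟪x, laplacePrimeAk L m n φ η U a' (c₁ := c₁) x⟫_ℂ)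
        (hpos'₁ : ∀ x : SiteL2K ℂ d (towerP L m (n + 1)) c₀ W, x ≠ 0 →
          0 < RCLike.re ⟪x, laplacePrimeAk L m n φ η (fun _ : Bond d (towerP L m (n + 1)) => (1 : 𝔸ˣ)) a' (c₁ := c₁) x⟫_ℂ)
        (hpos₁ : ∀ x : BondL2K ℂ d (towerP L m (n + 1)) c₀ W, x ≠ 0 →
          0 < RCLike.re ⟪x, laplaceAk L m n φ η (fun _ : Bond d (towerP L m (n + 1)) => (1 : 𝔸ˣ)) hL (fun _ => 0) (fun _ => by norm_num)
            (perCfg_UlevOf_one_mem_U1 L m (n + 1)) (norm_Wcx_UlevOf_one_sub_one_le L m (n + 1) (fun _ => 0) (fun _ => le_rfl)) τ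
            (c₀ := c₀) (c₁ := c₁) a x⟫_ℂ),
      ∀ (v : TSite d m) (f : BondL2K ℂ d (towerP L m (n + 1)) c₀ W) (F : ℝ),
        (∀ b', blockCoord (L ^ (n + 1)) m (siteCast (towerP_eq_fineP_pow L m (n + 1)) (bpos b')) ≠ v →
          WL2.equiv ℂ (fun _ : Bond d (towerP L m (n + 1)) => c₀) W f b' = 0) →
        (∀ b', ‖WL2.equiv ℂ (fun _ : Bond d (towerP L m (n + 1)) => c₀) W f b'‖ ≤ F) →
      ∀ bd : Bond d (towerP L m (n + 1)),
        ‖WL2.equiv ℂ (fun _ : Bond d (towerP L m (n + 1)) => c₀) W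
            (laplaceAk L m n φ η U hL αU hα1 hU1 hreg τ (c₀ := c₀) (c₁ := c₁) a
                (G1k L m n φ η (fun _ : Bond d (towerP L m (n + 1)) => (1 : 𝔸ˣ)) hL (fun _ => 0) (fun _ => by norm_num)
                  (perCfg_UlevOf_one_mem_U1 L m (n + 1)) (norm_Wcx_UlevOf_one_sub_one_le L m (n + 1) (fun _ => 0) (fun _ => le_rfl)) τ
                  (c₀ := c₀) (c₁ := c₁) hpos₁ f) -
              laplaceAk L m n φ η (fun _ : Bond d (towerP L m (n + 1)) => (1 : 𝔸ˣ)) hL (fun _ => 0) (fun _ => by norm_num)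
                (perCfg_UlevOf_one_mem_U1 L m (n + 1)) (norm_Wcx_UlevOf_one_sub_one_le L m (n + 1) (fun _ => 0) (fun _ => le_rfl)) τ (c₀ := c₀) (c₁ := c₁) a
                (G1k L m n φ η (fun _ : Bond d (towerP L m (n + 1)) => (1 : 𝔸ˣ)) hL (fun _ => 0) (fun _ => by norm_num)
                  (perCfg_UlevOf_one_mem_U1 L m (n + 1)) (norm_Wcx_UlevOf_one_sub_one_le L m (n + 1) (fun _ => 0) (fun _ => le_rfl)) τ
                  (c₀ := c₀) (c₁ := c₁) hpos₁ f)) bd‖ ≤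
          K * α * Real.exp (-(κ * tdist m (blockCoord (L ^ (n + 1)) m (siteCast (towerP_eq_fineP_pow L m (n + 1)) (bpos bd))) v)) * F := by
  classical
  obtain ⟨αH, KH, κH, hαH, hKH, hκH, HH⟩ :=
    exists_letter_hessOp_sub_flat_G1k_one hd L hL hL3 φ hMφ hMφ' hφ hφ' hstar ha ha' τ hτ hCτ hτm hMτ hρw hτ₁ hτ₂ hφτ
  obtain ⟨αD, KD, κD, hαD, hKD, hκD, HD⟩ :=
    exists_letter_gradDiv_sub_flat_G1k_one hd L hL hL3 φ hMφ hMφ' hφ hφ' hstar ha ha' τ hτ hCτ hτm hMτ hρw hτ₁ hτ₂ hφτ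
  obtain ⟨αW, KW, κW, hαW, hKW, hκW, HW⟩ :=
    exists_letter_projWord_sub_flat_G1k_one hd L hL hL3 φ hMφ hMφ' hφ hφ' hstar ha ha' hr0 hr1 τ hτ hCτ hτm hMτ hρw hτ₁ hτ₂ hφτ b hM₂ hrepr AQ
  obtain ⟨αQ, KQ, κQ, hαQ, hKQ, hκQ, HQ⟩ :=
    exists_letter_penalty_sub_flat_G1k_one hd L hL hL3 φ hMφ hMφ' hφ hφ' hstar ha ha' hr0 hr1 τ hτ hCτ hτm hMτ hρw hτ₁ hτ₂ hφτ AQ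
  set κ : ℝ := min (min κH κD) (min κW κQ) with hκdef
  have hκ0 : 0 < κ := lt_min (lt_min hκH hκD) (lt_min hκW hκQ)
  have hκH' : κ ≤ κH := (min_le_left _ _).trans (min_le_left _ _)
  have hκD' : κ ≤ κD := (min_le_left _ _).trans (min_le_right _ _)
  have hκW' : κ ≤ κW := (min_le_right _ _).trans (min_le_left _ _)
  have hκQ' : κ ≤ κQ := (min_le_right _ _).trans (min_le_right _ _)
  refine ⟨min (min αH αD) (min αW αQ), KH + KD + KW + KQ, κ, lt_min (lt_min hαH hαD) (lt_min hαW hαQ), by positivity, hκ0, ?_⟩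
  intro n η hηL c₀ c₁ _ _ hw hρ m _ hm U α hα hαle hUb hUη hUw hpl hUst αU hα0U hα1 hAQ hU1 hreg εU hε0 hε1 hεr hlev hlev1 hRlev hposU' hpos'₁ hpos₁
    v f F hfv hfF bd
  have hαH' : α ≤ αH := hαle.trans ((min_le_left _ _).trans (min_le_left _ _))
  have hαD' : α ≤ αD := hαle.trans ((min_le_left _ _).trans (min_le_right _ _))
  have hαW' : α ≤ αW := hαle.trans ((min_le_right _ _).trans (min_le_left _ _))
  have hαQ' : α ≤ αQ := hαle.trans ((min_le_right _ _).trans (min_le_right _ _))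
  have hF : 0 ≤ F := (norm_nonneg _).trans (hfF bd)
  -- the block family of the smooth-word piece, inhabited
  obtain ⟨rr, hrr0⟩ := exists_block_clm_family (𝕜 := ℂ) (w := fun _ : TSite d m => c₁) (V := W) (fun y : TSite d m => y)
  have hrr : ∀ (y : TSite d m) (g : SiteL2K ℂ d m c₁ W) (y' : TSite d m),
      WL2.equiv ℂ (fun _ : TSite d m => c₁) W (rr y g) y' = if y' = y then WL2.equiv ℂ (fun _ : TSite d m => c₁) W g y' else 0 :=
    fun y g y' => by simpa using hrr0 y g y'
  -- names
  set E : ℝ := Real.exp (-(κ * tdist m (blockCoord (L ^ (n + 1)) m (siteCast (towerP_eq_fineP_pow L m (n + 1)) (bpos bd))) v)) with hE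
  set g := G1k L m n φ η (fun _ : Bond d (towerP L m (n + 1)) => (1 : 𝔸ˣ)) hL (fun _ => 0) (fun _ => by norm_num)
    (perCfg_UlevOf_one_mem_U1 L m (n + 1)) (norm_Wcx_UlevOf_one_sub_one_le L m (n + 1) (fun _ => 0) (fun _ => le_rfl)) τ (c₀ := c₀) (c₁ := c₁) hpos₁ f with hg
  set DU := covDerivL2K ℂ c₀ ((η : ℂ))⁻¹ (adTransportW φ U) with hDU
  set D1 := covDerivL2K ℂ c₀ ((η : ℂ))⁻¹ (adTransportW φ (fun _ : Bond d (towerP L m (n + 1)) => (1 : 𝔸ˣ))) with hD1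
  set DdU := covDivL2K ℂ c₀ ((η : ℂ))⁻¹ (adTransportW φ fun b' => (U b')⁻¹) with hDdU
  set Dd1 := covDivL2K ℂ c₀ ((η : ℂ))⁻¹ (adTransportW φ fun b' => ((fun _ : Bond d (towerP L m (n + 1)) => (1 : 𝔸ˣ)) b')⁻¹) with hDd1
  set RU := RofUk L m n φ η U (c₀ := c₀) with hRU
  set R1 := RofUk L m n φ η (fun _ : Bond d (towerP L m (n + 1)) => (1 : 𝔸ˣ)) (c₀ := c₀) with hR1
  set Id := (LinearMap.id : SiteL2K ℂ d (towerP L m (n + 1)) c₀ W →ₗ[ℂ] SiteL2K ℂ d (towerP L m (n + 1)) c₀ W) with hId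
  set QU := QkW L m n φ U hL αU hα1 hU1 hreg (c₀ := c₀) (c₁ := c₁) with hQU
  set Q1 := QkW L m n φ (fun _ : Bond d (towerP L m (n + 1)) => (1 : 𝔸ˣ)) hL (fun _ => 0) (fun _ => by norm_num)
    (perCfg_UlevOf_one_mem_U1 L m (n + 1)) (norm_Wcx_UlevOf_one_sub_one_le L m (n + 1) (fun _ => 0) (fun _ => le_rfl)) (c₀ := c₀) (c₁ := c₁) with hQ1
  -- the weakening of each piece's rate to `κ`
  have hweak : ∀ {r' : ℝ} (t : ℝ), κ ≤ r' → 0 ≤ t → Real.exp (-(r' * t)) ≤ Real.exp (-(κ * t)) := fun t hr ht =>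
    Real.exp_le_exp.mpr (by nlinarith)
  have ht0 : 0 ≤ tdist m (blockCoord (L ^ (n + 1)) m (siteCast (towerP_eq_fineP_pow L m (n + 1)) (bpos bd))) v := tdist_nonneg _ _ _
  -- the four pieces at `bd`
  have h1 : ‖WL2.equiv ℂ (fun _ : Bond d (towerP L m (n + 1)) => c₀) W (hessOp φ η U τ g - hessOp φ η (fun _ : Bond d (towerP L m (n + 1)) => (1 : 𝔸ˣ)) τ g) bd‖ ≤
      KH * α * E * F := by
    refine (HH n η hηL c₀ c₁ hw hρ m hm U α hα hαH' hUb hUη hUw hpl hpos'₁ hpos₁ v f F hfv hfF bd).trans ?_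
    exact mul_le_mul_of_nonneg_right (mul_le_mul_of_nonneg_left (hweak _ hκH' ht0) (mul_nonneg hKH hα)) hF
  have h2 : ‖WL2.equiv ℂ (fun _ : Bond d (towerP L m (n + 1)) => c₀) W (DU (DdU g) - D1 (Dd1 g)) bd‖ ≤ KD * α * E * F := by
    refine (HD n η hηL c₀ c₁ hw hρ m hm U α hα hαD' hUb hUη hUw hpl hpos'₁ hpos₁ v f F hfv hfF bd).trans ?_
    exact mul_le_mul_of_nonneg_right (mul_le_mul_of_nonneg_left (hweak _ hκD' ht0) (mul_nonneg hKD hα)) hF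
  have h3 : ‖WL2.equiv ℂ (fun _ : Bond d (towerP L m (n + 1)) => c₀) W (DU ((Id - RU) (DdU g)) - D1 ((Id - R1) (Dd1 g))) bd‖ ≤ KW * α * E * F := by
    refine (HW n η hηL c₀ c₁ hw hρ m hm U α hα hαW' hUb hUη hUw hpl hUst αU hα0U hα1 hAQ hU1 hreg εU hε0 hε1 hεr hlev hlev1 hRlev hposU' hpos'₁ hpos₁ rr hrr
      v f F hfv hfF bd).trans ?_
    exact mul_le_mul_of_nonneg_right (mul_le_mul_of_nonneg_left (hweak _ hκW' ht0) (mul_nonneg hKW hα)) hF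
  have h4 : ‖WL2.equiv ℂ (fun _ : Bond d (towerP L m (n + 1)) => c₀) W
      (LinearMap.adjoint QU ((a : ℂ) • QU g) - LinearMap.adjoint Q1 ((a : ℂ) • Q1 g)) bd‖ ≤ KQ * α * E * F := by
    refine (HQ n η hηL c₀ c₁ hw hρ m hm U α hα hαQ' αU hα0U hα1 hAQ hU1 hreg εU hε0 hεr hlev hpos'₁ hpos₁ v f F hfv hfF bd).trans ?_
    exact mul_le_mul_of_nonneg_right (mul_le_mul_of_nonneg_left (hweak _ hκQ' ht0) (mul_nonneg hKQ hα)) hF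
  -- the split of `Δ_{a,k}(U)g − Δ_{a,k}(1)g` into the four pieces (`D R D† = D D† − D(1 − R)D†`)
  have hvec : laplaceAk L m n φ η U hL αU hα1 hU1 hreg τ (c₀ := c₀) (c₁ := c₁) a g -
      laplaceAk L m n φ η (fun _ : Bond d (towerP L m (n + 1)) => (1 : 𝔸ˣ)) hL (fun _ => 0) (fun _ => by norm_num)
        (perCfg_UlevOf_one_mem_U1 L m (n + 1)) (norm_Wcx_UlevOf_one_sub_one_le L m (n + 1) (fun _ => 0) (fun _ => le_rfl)) τ (c₀ := c₀) (c₁ := c₁) a g =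
      (hessOp φ η U τ g - hessOp φ η (fun _ : Bond d (towerP L m (n + 1)) => (1 : 𝔸ˣ)) τ g) +
        ((DU (DdU g) - D1 (Dd1 g)) - (DU ((Id - RU) (DdU g)) - D1 ((Id - R1) (Dd1 g)))) +
        (LinearMap.adjoint QU ((a : ℂ) • QU g) - LinearMap.adjoint Q1 ((a : ℂ) • Q1 g)) := by
    rw [laplaceAk_apply_slots, laplaceAk_apply_slots]
    simp only [hDU, hD1, hDdU, hDd1, hRU, hR1, hId, hQU, hQ1, LinearMap.sub_apply, LinearMap.id_apply, map_sub]
    abel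
  rw [hvec, WL2.equiv_add, WL2.equiv_add, Pi.add_apply, Pi.add_apply]
  have h23 : ‖WL2.equiv ℂ (fun _ : Bond d (towerP L m (n + 1)) => c₀) W
      ((DU (DdU g) - D1 (Dd1 g)) - (DU ((Id - RU) (DdU g)) - D1 ((Id - R1) (Dd1 g)))) bd‖ ≤ KD * α * E * F + KW * α * E * F := by
    rw [WL2.equiv_sub, Pi.sub_apply]
    exact (norm_sub_le _ _).trans (add_le_add h2 h3)
  calc _ ≤ KH * α * E * F + (KD * α * E * F + KW * α * E * F) + KQ * α * E * F := (norm_add₃_le).trans (add_le_add (add_le_add h1 h23) h4)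
    _ = (KH + KD + KW + KQ) * α * E * F := by ring

/-! ## §2 The bond storey: `G₁,k(U) − G₁,k(1)` as a local letter with the small factor -/

include hd hL hL3 hMφ hMφ' hφ hφ' hstar ha ha' hr0 hr1 hτ hCτ hτm hMτ hρw hτ₁ hτ₂ hφτ hM₂ hrepr in
set_option maxHeartbeats 3200000 in
/-- **THE TWO-BACKGROUND LADDER OF THE `k`-LEVEL BOND PROPAGATOR `G₁,k` AT THE FLAT BASE, AS A LOCAL LETTER WITH THE SMALL FACTOR `α`, CONSTANTS BEFORE THE LATTICE** — see the
module docstring: `G₁,k(U)f − G₁,k(1)f = −G₁,k(U)((Δ_{a,k}(U) − Δ_{a,k}(1))G₁,k(1)f)`, the inner letter by §1, the outer by the MODEL row of `G₁,k(U)`, composed over the unit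
lattice. [cite: Balaban1985BackgroundPropagators, (3.84)–(3.86) p.407, Thm 3.3 p.399, Thm 3.11 p.416, (3.26) p.395] -/
theorem exists_letter_G1k_sub_flat :
    ∃ α₀ K κ : ℝ, 0 < α₀ ∧ 0 ≤ K ∧ 0 < κ ∧
      ∀ (n : ℕ) (η : ℝ), η * (L : ℝ) ^ (n + 1) = 1 →
      ∀ (c₀ c₁ : ℝ) [Fact (0 < c₀)] [Fact (0 < c₁)], c₀ * ((L : ℝ) ^ (n + 1)) ^ d = c₁ → |η| ^ d / c₀ ≤ ρw →
      ∀ (m : Fin d → ℕ) [∀ i, NeZero (m i)], (∀ i, 1 ≤ m i) → ∀ (U : Bond d (towerP L m (n + 1)) → 𝔸ˣ) (α : ℝ), 0 ≤ α → α ≤ α₀ →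
        (∀ bd, U bd ∈ U1 𝔸) → (∀ bd, ‖(U bd : 𝔸) - 1‖ ≤ α * η) →
        (∀ (x : TSite d (towerP L m (n + 1))) (μ ν : Fin d), ‖(U (shift ν x, μ) : 𝔸) - (U (x, μ) : 𝔸)‖ ≤ α * η ^ 2) →
        (∀ p : B9SectCLatticeCarrier.Plaq d (towerP L m (n + 1)), ‖(plaqHolU U p : 𝔸) - 1‖ ≤ α * η ^ 2) →
      ∀ (hUst : ∀ bd, star (U bd : 𝔸) = (((U bd)⁻¹ : 𝔸ˣ) : 𝔸))
        (αU : ℕ → ℝ), (∀ j, 0 ≤ αU j) → ∀ (hα1 : ∀ j, αU j ≤ 1 / 64), (∑ j ∈ Finset.range (n + 1), αU j ≤ AQ) →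
        ∀ (hU1 : ∀ (j : ℕ) (x : B7Prop1Explicit.Site d) (k : Fin d), perCfg (towerP L m (j + 1)) (UlevOf L m (n + 1) U j) x k ∈ U1 𝔸)
        (hreg : ∀ (j : ℕ) (y : TSite d (towerP L m j)) (k : Fin d) (ρ' : Fin d → Fin L),
          ‖((Wcx L (perCfg (towerP L m (j + 1)) (UlevOf L m (n + 1) U j)) (cornerSite L y) k (boxVec L ρ') : 𝔸ˣ) : 𝔸) - 1‖ ≤ αU j),
      ∀ (εU : ℕ → ℝ), (∀ j, 0 ≤ εU j) → (∀ j, εU j ≤ 1) → (∀ j < n + 1, εU j ≤ α * r ^ j) →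
        (∀ (j : ℕ) (bd : Bond d (towerP L m (j + 1))), ‖(UlevOf L m (n + 1) U j bd : 𝔸) - 1‖ ≤ εU j) →
        (∀ (j : ℕ) (bd : Bond d (towerP L m (j + 1))), UlevOf L m (n + 1) U j bd ∈ U1 𝔸) →
        (∀ (j : ℕ) (bd : Bond d (towerP L m (j + 1))) (w : W), ‖adTransportW φ (UlevOf L m (n + 1) U j) bd w‖ ≤ ‖w‖) →
      ∀ (hposU' : ∀ x : SiteL2K ℂ d (towerP L m (n + 1)) c₀ W, x ≠ 0 → 0 < RCLike.re ⟪x, laplacePrimeAk L m n φ η U a' (c₁ := c₁) x⟫_ℂ)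
        (hposU : ∀ x : BondL2K ℂ d (towerP L m (n + 1)) c₀ W, x ≠ 0 →
          0 < RCLike.re ⟪x, laplaceAk L m n φ η U hL αU hα1 hU1 hreg τ (c₀ := c₀) (c₁ := c₁) a x⟫_ℂ)
        (hpos'₁ : ∀ x : SiteL2K ℂ d (towerP L m (n + 1)) c₀ W, x ≠ 0 →
          0 < RCLike.re ⟪x, laplacePrimeAk L m n φ η (fun _ : Bond d (towerP L m (n + 1)) => (1 : 𝔸ˣ)) a' (c₁ := c₁) x⟫_ℂ)
        (hpos₁ : ∀ x : BondL2K ℂ d (towerP L m (n + 1)) c₀ W, x ≠ 0 →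
          0 < RCLike.re ⟪x, laplaceAk L m n φ η (fun _ : Bond d (towerP L m (n + 1)) => (1 : 𝔸ˣ)) hL (fun _ => 0) (fun _ => by norm_num)
            (perCfg_UlevOf_one_mem_U1 L m (n + 1)) (norm_Wcx_UlevOf_one_sub_one_le L m (n + 1) (fun _ => 0) (fun _ => le_rfl)) τ
            (c₀ := c₀) (c₁ := c₁) a x⟫_ℂ),
      ∀ (v : TSite d m) (f : BondL2K ℂ d (towerP L m (n + 1)) c₀ W) (F : ℝ),
        (∀ b', blockCoord (L ^ (n + 1)) m (siteCast (towerP_eq_fineP_pow L m (n + 1)) (bpos b')) ≠ v →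
          WL2.equiv ℂ (fun _ : Bond d (towerP L m (n + 1)) => c₀) W f b' = 0) →
        (∀ b', ‖WL2.equiv ℂ (fun _ : Bond d (towerP L m (n + 1)) => c₀) W f b'‖ ≤ F) →
      ∀ bd : Bond d (towerP L m (n + 1)),
        ‖WL2.equiv ℂ (fun _ : Bond d (towerP L m (n + 1)) => c₀) W
            (G1k L m n φ η U hL αU hα1 hU1 hreg τ (c₀ := c₀) (c₁ := c₁) hposU f -
              G1k L m n φ η (fun _ : Bond d (towerP L m (n + 1)) => (1 : 𝔸ˣ)) hL (fun _ => 0) (fun _ => by norm_num)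
                (perCfg_UlevOf_one_mem_U1 L m (n + 1)) (norm_Wcx_UlevOf_one_sub_one_le L m (n + 1) (fun _ => 0) (fun _ => le_rfl)) τ
                (c₀ := c₀) (c₁ := c₁) hpos₁ f) bd‖ ≤
          K * α * Real.exp (-(κ * tdist m (blockCoord (L ^ (n + 1)) m (siteCast (towerP_eq_fineP_pow L m (n + 1)) (bpos bd))) v)) * F := by
  classical
  obtain ⟨αV, KV, κV, hαV, hKV, hκV, HV⟩ :=
    exists_letter_laplaceAk_sub_flat_G1k_one hd L hL hL3 φ hMφ hMφ' hφ hφ' hstar ha ha' hr0 hr1 τ hτ hCτ hτm hMτ hρw hτ₁ hτ₂ hφτ b hM₂ hrepr AQ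
  obtain ⟨αG, BG, δG, hαG, hBG, hδG, ROWU⟩ :=
    exists_local_letter_G1k hd L hL hL3 φ hMφ hMφ' hφ hφ' hstar ha ha' (ϱ := r) hr0 hr1 τ hτ hCτ hτm hMτ hρw hτ₁ hτ₂ hφτ AQ
  set κf : ℝ := min κV δG / 2 with hκf
  have hmin0 : 0 < min κV δG := lt_min hκV hδG
  have hκf0 : 0 < κf := by positivity
  have hκfV : κf ≤ κV := by
    have := min_le_left κV δG
    rw [hκf]; linarith
  have hrate : 0 < δG - κf := by
    have := min_le_right κV δG
    rw [hκf]; linarith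
  set S : ℝ := latticeConst d (δG - κf) with hS
  have hS0 : 0 ≤ S := latticeConst_nonneg d hrate.le
  refine ⟨min αV αG, KV * BG * S, κf, lt_min hαV hαG, by positivity, hκf0, ?_⟩
  intro n η hηL c₀ c₁ _ _ hw hρ m _ hm U α hα hαle hUb hUη hUw hpl hUst αU hα0U hα1 hAQ hU1 hreg εU hε0 hε1 hεr hlev hlev1 hRlev hposU' hposU hpos'₁ hpos₁
    v f F hfv hfF bd
  have hαV' : α ≤ αV := hαle.trans (min_le_left _ _)
  have hαG' : α ≤ αG := hαle.trans (min_le_right _ _)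
  have hF : 0 ≤ F := (norm_nonneg _).trans (hfF bd)
  haveI : Nonempty (Bond d (towerP L m (n + 1))) := ⟨bd⟩
  have hUgrad : ∀ (x : TSite d (towerP L m (n + 1))) (μ : Fin d), ‖(U (x, μ) : 𝔸) - U (unshift μ x, μ)‖ ≤ α * η ^ 2 := fun x μ => by
    have h := hUw (unshift μ x) μ μ
    rwa [shift_unshift] at h
  -- names
  set piB : Bond d (towerP L m (n + 1)) → TSite d m := fun b' => blockCoord (L ^ (n + 1)) m (siteCast (towerP_eq_fineP_pow L m (n + 1)) (bpos b')) with hpiB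
  set G1 := G1k L m n φ η (fun _ : Bond d (towerP L m (n + 1)) => (1 : 𝔸ˣ)) hL (fun _ => 0) (fun _ => by norm_num)
    (perCfg_UlevOf_one_mem_U1 L m (n + 1)) (norm_Wcx_UlevOf_one_sub_one_le L m (n + 1) (fun _ => 0) (fun _ => le_rfl)) τ (c₀ := c₀) (c₁ := c₁) hpos₁ with hG1
  set GU := G1k L m n φ η U hL αU hα1 hU1 hreg τ (c₀ := c₀) (c₁ := c₁) hposU with hGU
  set ΔU := laplaceAk L m n φ η U hL αU hα1 hU1 hreg τ (c₀ := c₀) (c₁ := c₁) a with hΔU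
  set Δ1 := laplaceAk L m n φ η (fun _ : Bond d (towerP L m (n + 1)) => (1 : 𝔸ˣ)) hL (fun _ => 0) (fun _ => by norm_num)
    (perCfg_UlevOf_one_mem_U1 L m (n + 1)) (norm_Wcx_UlevOf_one_sub_one_le L m (n + 1) (fun _ => 0) (fun _ => le_rfl)) τ (c₀ := c₀) (c₁ := c₁) a with hΔ1
  obtain ⟨TV, hTV⟩ : ∃ T : BondL2K ℂ d (towerP L m (n + 1)) c₀ W →L[ℂ] BondL2K ℂ d (towerP L m (n + 1)) c₀ W,
      T = LinearMap.toContinuousLinearMap ((ΔU - Δ1) ∘ₗ G1) := ⟨_, rfl⟩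
  obtain ⟨TG, hTG⟩ : ∃ T : BondL2K ℂ d (towerP L m (n + 1)) c₀ W →L[ℂ] BondL2K ℂ d (towerP L m (n + 1)) c₀ W,
      T = LinearMap.toContinuousLinearMap GU := ⟨_, rfl⟩
  -- (1) the letters of `V G₁,k(1)` (§1) and of `G₁,k(U)` (MODEL row at `U`)
  have hLV : ∀ (v : TSite d m) (f : BondL2K ℂ d (towerP L m (n + 1)) c₀ W) (F : ℝ), (∀ x, piB x ≠ v → WL2.equiv ℂ (fun _ : Bond d (towerP L m (n + 1)) => c₀) W f x = 0) →
      (∀ x, ‖WL2.equiv ℂ (fun _ : Bond d (towerP L m (n + 1)) => c₀) W f x‖ ≤ F) →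
      ∀ b', ‖WL2.equiv ℂ (fun _ : Bond d (towerP L m (n + 1)) => c₀) W (TV f) b'‖ ≤ (KV * α) * Real.exp (-(κV * tdist m (piB b') v)) * F := by
    intro v f F hfv hfF b'
    rw [hTV, LinearMap.coe_toContinuousLinearMap', LinearMap.comp_apply, LinearMap.sub_apply]
    exact HV n η hηL c₀ c₁ hw hρ m hm U α hα hαV' hUb hUη hUw hpl hUst αU hα0U hα1 hAQ hU1 hreg εU hε0 hε1 hεr hlev hlev1 hRlev hposU' hpos'₁ hpos₁ v f F hfv hfF b'
  have hLG : ∀ (v : TSite d m) (f : BondL2K ℂ d (towerP L m (n + 1)) c₀ W) (F : ℝ), (∀ x, piB x ≠ v → WL2.equiv ℂ (fun _ : Bond d (towerP L m (n + 1)) => c₀) W f x = 0) →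
      (∀ x, ‖WL2.equiv ℂ (fun _ : Bond d (towerP L m (n + 1)) => c₀) W f x‖ ≤ F) →
      ∀ b', ‖WL2.equiv ℂ (fun _ : Bond d (towerP L m (n + 1)) => c₀) W (TG f) b'‖ ≤ BG * Real.exp (-(δG * tdist m (piB b') v)) * F := by
    intro v f F hfv hfF b'
    rw [hTG, LinearMap.coe_toContinuousLinearMap']
    exact ROWU n η hηL c₀ c₁ hw hρ m hm U αU hα0U hα1 hU1 hreg εU hε0 hlev hlev1 α hα hαG' hUst hUb hUη hpl hUgrad hRlev hεr hAQ hposU' hposU v f F hfv hfF b'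
  -- (2) the composition over the unit lattice
  have hrow : ∀ w : TSite d m, ∑ u, Real.exp (-((δG - κf) * tdist m w u)) ≤ S := fun w => torusSum_le d hm hrate w
  have hδ0 : ∀ u v : TSite d m, 0 ≤ tdist m u v := fun u v => tdist_nonneg _ _ _
  have hδt : ∀ u y v : TSite d m, tdist m u v ≤ tdist m u y + tdist m y v := fun u y v => tdist_triangle hm u y v
  have hC := letter_comp (𝕜 := ℂ) (tdist m) piB piB piB TV TG hδ0 hδt (mul_nonneg hKV hα) hBG hκf0.le hκfV hLV hLG hrow v f F hfv hfF bd
  -- (3) the resolvent identity `G(1)f − G(U)f = G(U)((Δ(U) − Δ(1))G(1)f)`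
  have e1 : Δ1 (G1 f) = f := laplaceAk_G1k_apply L hL φ τ n η m _ _ _ _ _ hpos₁ f
  have e2 : GU (ΔU (G1 f)) = G1 f := G1k_laplaceAk_apply L hL φ τ n η m U αU hα1 hU1 hreg hposU (G1 f)
  have hid : G1 f - GU f = (TG ∘L TV) f := by
    rw [hTG, hTV]
    simp only [ContinuousLinearMap.coe_comp, Function.comp_apply, LinearMap.coe_toContinuousLinearMap', LinearMap.comp_apply, LinearMap.sub_apply, map_sub]
    rw [e2, e1]
  rw [WL2.equiv_sub, Pi.sub_apply, norm_sub_rev, ← Pi.sub_apply, ← WL2.equiv_sub, hid]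
  exact hC.trans (le_of_eq (by ring))

end Literature.MathematicalPhysics.QuantumFieldTheory.Balaban1983to89.B9Eq386BondPropagatorTwoBackgroundLetterTower

end
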